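import Literature.MathematicalPhysics.QuantumFieldTheory.Balaban1983to89.B6LeafB6OneLevel
import Literature.MathematicalPhysics.QuantumFieldTheory.Balaban1983to89.B6Prop25OneLevelFamG

/-!
# `Balaban1983to89.B6LeafB6OneLevelFamG` — [B6] **the DAG leaf `b6` (`DagBinding.B6BlockParam`: Lemma 2.1 with ∃ c₁(α) ∧ Props. 2.2, 2.3 ∧
# Lemma 2.4 ∧ Props. 2.5, 2.6, 2.7 ∧ Cor. 2.8 — the eight statements of [Balaban1984PropagatorsII], verbatim) on the one-level knit block
# whose Proposition-2.5 carrier is [4]'s GENUINE torus family of record** (`B6Prop25OneLevelFamG.locG`: every (1.110)–(1.114) functional the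
# concrete quantity in `(Δ_a)⁻¹`) — the companion of `B6LeafB6OneLevel`, whose block reads Prop. 2.5 on p09's `settingOf` carrier (genuine for
# (1.110)₁,₂ and (1.111)₁ only, the other slots `0`)

FRAMING (verbatim cell line):
statement-level skeleton of published theorems with citation tags; proofs where landed; nothing here is a claim about the Yang–Mills mass gap

Sources (cell `lit-balaban`; seat **r03 gen 14** = the B6 fold owner, own lane; SKELETON row **B6.Main** (decl column `B6.StatedBlock` /
`B6.MainResults` / `DagBinding.B6BlockParam`) — a MEMBER cell: the same knit as r03 g11's `B6BlockParamOneLevel`/`B6LeafB6OneLevel` with ONE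
carrier swapped): T. Bałaban, *Propagators and renormalization transformations for lattice gauge theories. II*, Commun. Math. Phys. **96** (1984)
223–250 [`Balaban1984PropagatorsII`, "B6"], pp. 223–250: Lemma 2.1 p. 234, Prop. 2.2 p. 234, Prop. 2.3 p. 238, Lemma 2.4 p. 245, Prop. 2.5 p. 246,
Prop. 2.6 p. 247, Prop. 2.7 p. 249, Cor. 2.8 p. 249; PDF held `paper:balaban1984-cmp96-propagators-rt-ii` (journal page = PDF page + 222).

WHY THIS FILE.  `B6BlockParamOneLevel.knitBlock` takes its local operators from `B6Prop25OneLevelV1.loc` (r03 g10), whose (1.110)–(1.114)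
functionals are p09's `BIJ85Ineq722ProofPart2.settingOf` — genuine for (1.110) `m = 0, 1` and (1.111)₁ only, the other slots the constant `0`
(p19's `BIJ85Prop12AllTori` header; located for the B6 rows by p22 g14 / r03 g14).  So in `B6LeafB6OneLevel.b6BlockParam_oneLevel` the Prop. 2.5
conjunct certifies (1.110)₃,₄, (1.111)₂, (1.112)–(1.114) only vacuously.  Here the knit is repeated with `loc := B6Prop25OneLevelFamG.locG d L a`
([4]'s family of record `B5Prop12GLattice.famG`: r02's `latticeSettingP12R (L^k) (Mk P k) a k`, EVERY slot concrete; Prop. 2.5 for it =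
`B6Prop25OneLevelFamG.prop25Printed_oneLevel_famG`); the other seven conjuncts are r03 g11's theorems BY NAME (they do not mention `loc`:
`B6BlockParamOneLevel.lemma21Param_oneLevel`, `prop23Printed_block`, `B6Lemma24Printed.lemma24Printed_carrier`, `prop27Printed_block`,
`B6MainResultsOneLevel.prop26Printed_block`/`cor28Printed_block`, `B6Prop22BlockFamily.prop22Printed_block`).  Nothing of the g11 files is
modified; `knitBlock`/`b6BlockParam_oneLevel` stay on file as the `settingOf`-member.

## WHAT THIS FILE PROVES (kernel-checked; 0 sorry; one definition with body `knitBlockG`, theorems otherwise)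

* `knitBlockG d L a δ₀ Gp` — `B6MainResultsOneLevel.oneLevelBlock` with `Cinv := blockCinv`, `Qinv := blockQinv`, the tree-gauge carriers of
  `B6Lemma24Carrier` (index `TreeIdx`) — all as in `knitBlock` — and **`loc := B6Prop25OneLevelFamG.locG d L a`** (index `B6Prop25OneLevelV1.Idx d L`).
* `seven_of_eight_knitG`, **`b6BlockParam_knitG_iff`** (the leaf on `knitBlockG` ⟺ its Prop. 2.2 conjunct), `mainResults_knitG`,
  `knitG_meets_hypotheses` — verbatim the g11 statements on the new block.
* **`b6BlockParam_oneLevel_famG (hd : 2 ≤ d) (hL : Odd L ∧ 1 < L) (ha : 0 < a) (hδ : 0 < δ₀) (hmsq : 0 ≤ msq) :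
  DagBinding.B6BlockParam (knitBlockG d L a δ₀ (blockGp d L a msq))`** — the leaf, all eight conjuncts, the Prop. 2.5 conjunct graded on the
  genuine functionals; `b6BlockRest_oneLevel_famG`; `mainResults_oneLevel_famG`.
* **`leaf_b6_knitG (hd) (hL) (ha)`** — non-vacuity on the NAMED block `knitBlockG d L a 1 (blockGp d L a 0)` (index inhabited ∧ every member meets
  `Hyp21_22 ∧ 1 ≤ M` ∧ `DagBinding.B6BlockParam`), with `knitBlockG_loc_S` (the carrier identity, `rfl`); the carrier-free existential is r03 g11's
  `B6LeafB6OneLevel.leaf_b6_inhabited` (same type — not restated here).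

## HONEST SCOPE ∕ NOT CLAIMED

Exactly the scope of `B6LeafB6OneLevel` (ONE LEVEL: Ω₁ = … = Ω_K = T_η, `R = M = 1`, (2.1)–(2.2) void, scalar model, torus, `d ≥ 2`, odd `L > 1`,
`a > 0`, `m² ≥ 0`, constants OURS; Lemma 2.1 in PARAMETER form — the printed c₁(α) is refuted as typed for d ≥ 3 on multi-level geometries,
G-A11-1; the (2.67) functionals vanish on the 2-tensor source kinds (declared device of `B6Prop22BlockFamily`); Props. 2.3/2.7 kernels read through
bond base points) with ONE improvement: the Prop. 2.5 conjunct is read on [4]'s genuine family of record (`famG`), every (1.110)–(1.114) slot the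
concrete cube-sup / Hölder / cut-`L²` quantity in `(DeltaA (L^k) (Mk P k) a)⁻¹ *ᵥ J` — THE operator of the (2.129) conjunct
(`B6Prop25OneLevelFamG.oneLevelData_G_apply_eq_re_inv_DeltaA`); (1.114) there is proved by a Combes–Thomas route (`B5CombesThomasLattice`), declared
in `B5Prop12GHolds`.  The genuinely multi-level leaf (k ≥ 2 distinct levels, the glueings (2.50)/(2.86)/(2.141), `M` large) remains the DAG
HYPOTHESIS `Upstream.b6` of every binder that does not choose these carriers; `B6.StatedBlock` (the literal c₁(α)) is NOT claimed.  Value = the DAG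
leaf inhabited, non-vacuously, by one family of model carriers with no vacuous census slot outside the declared 2-tensor device; NOT summit
progress.  Unit `lit-balaban-r03` (gen 14), 2026-08-22.
-/

noncomputable section

namespace Literature.MathematicalPhysics.QuantumFieldTheory.Balaban1983to89.B6LeafB6OneLevelFamG

open Literature.MathematicalPhysics.QuantumFieldTheory.Balaban1983to89.B6 (BlockData MainResults Lemma24Printed Prop22Printed Prop23Printed
  Prop25Printed Prop26Printed Prop27Printed Cor28Printed)
open B6MainResultsOneLevel (blockGeo blockG blockH oneLevelBlock prop26Printed_block cor28Printed_block mainResults_oneLevel)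
open B6BlockParamOneLevel (TreeIdx blockCinv blockQinv lemma21Param_oneLevel prop23Printed_block prop27Printed_block)
open B6Prop22BlockFamily (blockGp prop22Printed_block)
open B6Lemma24Carrier (carrier q1Of)
open B6Lemma24Printed (lemma24Printed_carrier)
open B6Prop25OneLevelV1 (Idx)
open B6Prop25OneLevelFamG (locG prop25Printed_oneLevel_famG)
open B5ResidualGpTorusHolds (TopIdx)
open B5Eq117TorusCarriers (Mk)
open B5SettingP12Real (latticeSettingP12R)
open DagBinding (B6Lemma21Param B6BlockParam B6BlockRest b6BlockParam_mainResults)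

section Knit

variable (d L : ℕ) (a : ℝ)

/-- **the one-level knit block with the GENUINE Prop. 2.5 carrier**: `oneLevelBlock` with `Cinv := blockCinv`, `Qinv := blockQinv`, the
tree-gauge carriers of `B6Lemma24Carrier` (index `TreeIdx`) — as in r03 g11's `knitBlock` — and the local operators
`B6Prop25OneLevelFamG.locG d L a` (index `Idx d L`; [4]-functionals = `famG`). The (2.67) functionals `Gp` remain a parameter.
[cite: Balaban1984PropagatorsII, pp.223–250 (the carriers of `B6.BlockData`)] -/
def knitBlockG (δ₀ : ℝ) (Gp : ∀ i : TopIdx d L, B6.GpFamily (blockGeo d L a i)) : BlockData :=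
  oneLevelBlock d L a δ₀ Gp (blockCinv d L a) (blockQinv d L a) (TreeIdx d L) (fun t => carrier L t.1 (q1Of L t.1))
    (Idx d L) (locG d L a)

/-- the local operators of the block are `locG` (definitional). [cite: Balaban1984PropagatorsII, Prop. 2.5 p.246, dictionary] -/
theorem knitBlockG_loc (δ₀ : ℝ) (Gp : ∀ i : TopIdx d L, B6.GpFamily (blockGeo d L a i)) :
    (knitBlockG d L a δ₀ Gp).loc = locG d L a := rfl

/-- **the Prop. 2.5 carrier of every local operator of the block IS r02's real weighted setting `latticeSettingP12R (L^k) (Mk P k) a k`** (every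
(1.110)–(1.114) slot concrete in `(DeltaA (L^k) (Mk P k) a)⁻¹`; `B6Prop25OneLevelFamG.locG_S`). [cite: Balaban1984PropagatorsI, Prop. 1.2 pp.35–36, dictionary] -/
theorem knitBlockG_loc_S (δ₀ : ℝ) (Gp : ∀ i : TopIdx d L, B6.GpFamily (blockGeo d L a i)) (k : Idx d L) :
    ((knitBlockG d L a δ₀ Gp).loc k).S = latticeSettingP12R (k.1.1.L ^ k.1.2) (Mk k.1.1 k.1.2) a k.1.2 := rfl

/-- Lemma 2.4 WITH THE PRINTED CONSTANT holds for the block's trees (b06's `lemma24Printed_carrier`, every `d ≥ 2`, `L ≥ 1`).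
[cite: Balaban1984PropagatorsII, Lemma 2.4 (2.128) p.245] -/
theorem lemma24Printed_knitG (hd : 2 ≤ d) (hL : 1 ≤ L) (δ₀ : ℝ) (Gp : ∀ i : TopIdx d L, B6.GpFamily (blockGeo d L a i)) :
    Lemma24Printed (knitBlockG d L a δ₀ Gp).d (knitBlockG d L a δ₀ Gp).L (knitBlockG d L a δ₀ Gp).tree :=
  lemma24Printed_carrier hd hL (fun t : TreeIdx d L => t.1) fun t => t.2

/-- **Prop. 2.5 holds for the block's local operators, [4]-half on the genuine functionals** (`prop25Printed_oneLevel_famG`).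
[cite: Balaban1984PropagatorsII, Prop. 2.5 p.246] -/
theorem prop25Printed_knitG (ha : 0 < a) (δ₀ : ℝ) (Gp : ∀ i : TopIdx d L, B6.GpFamily (blockGeo d L a i)) :
    Prop25Printed (knitBlockG d L a δ₀ Gp).loc :=
  prop25Printed_oneLevel_famG d L ha

/-- **the seven discharged conjuncts of the leaf on the block**, as one conjunction (Lemma 2.1-param ∧ Prop. 2.3 ∧ Lemma 2.4 ∧ Prop. 2.5 ∧
Prop. 2.6 ∧ Prop. 2.7 ∧ Cor. 2.8), for every `d ≥ 2`, odd `L > 1`, `a > 0`, `δ₀ > 0` and every `Gp` — r03 g11's theorems by name, Prop. 2.5 from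
`B6Prop25OneLevelFamG`. [cite: Balaban1984PropagatorsII, Lemma 2.1 p.234, Prop. 2.3 p.238, Lemma 2.4 p.245, Prop. 2.5 p.246, Prop. 2.6 p.247, Prop. 2.7 p.249, Cor. 2.8 p.249] -/
theorem seven_of_eight_knitG (hd : 2 ≤ d) (hL : Odd L ∧ 1 < L) (ha : 0 < a) {δ₀ : ℝ} (hδ : 0 < δ₀)
    (Gp : ∀ i : TopIdx d L, B6.GpFamily (blockGeo d L a i)) :
    B6Lemma21Param (knitBlockG d L a δ₀ Gp) ∧ Prop23Printed d (blockGeo d L a) (blockCinv d L a) ∧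
      Lemma24Printed (knitBlockG d L a δ₀ Gp).d (knitBlockG d L a δ₀ Gp).L (knitBlockG d L a δ₀ Gp).tree ∧
      Prop25Printed (knitBlockG d L a δ₀ Gp).loc ∧ Prop26Printed (blockGeo d L a) (blockG d L a) ∧
      Prop27Printed d (blockGeo d L a) (blockQinv d L a) ∧ Cor28Printed d (blockGeo d L a) (blockH d L a) :=
  have hd1 : 1 ≤ d := le_trans one_le_two hd
  ⟨lemma21Param_oneLevel d L a hδ Gp _ _ _ _ _ _, prop23Printed_block d L a hd1 ha, lemma24Printed_knitG d L a hd (le_of_lt hL.2) δ₀ Gp,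
    prop25Printed_knitG d L a ha δ₀ Gp, prop26Printed_block d L a hd1 hL ha, prop27Printed_block d L a hd1 ha,
    cor28Printed_block d L a hd1⟩

/-- **LEAF `b6` ON THE BLOCK REDUCES TO ITS PROPOSITION 2.2 CONJUNCT** (as for `knitBlock`): `DagBinding.B6BlockParam` holds for `knitBlockG`
IFF its Prop. 2.2 conjunct holds for the chosen (2.67) functionals `Gp`. [cite: Balaban1984PropagatorsII, pp.223–250 (Lemma 2.1 p.234, Prop. 2.2 p.234, Prop. 2.3 p.238, Lemma 2.4 p.245, Prop. 2.5 p.246, Prop. 2.6 p.247, Prop. 2.7 p.249, Cor. 2.8 p.249)] -/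
theorem b6BlockParam_knitG_iff (hd : 2 ≤ d) (hL : Odd L ∧ 1 < L) (ha : 0 < a) {δ₀ : ℝ} (hδ : 0 < δ₀)
    (Gp : ∀ i : TopIdx d L, B6.GpFamily (blockGeo d L a i)) :
    B6BlockParam (knitBlockG d L a δ₀ Gp) ↔ Prop22Printed (blockGeo d L a) Gp := by
  obtain ⟨h21, h23, h24, h25, h26, h27, h28⟩ := seven_of_eight_knitG d L a hd hL ha hδ Gp
  constructor
  · rintro ⟨-, h22, -⟩
    exact h22
  · intro h22
    exact ⟨h21, h22, h23, h24, h25, h26, h27, h28⟩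

/-- **the MAIN RESULTS on the block** (an instance of `oneLevelBlock`; `B6MainResultsOneLevel.mainResults_oneLevel`).
[cite: Balaban1984PropagatorsII, p.249 («This Corollary and Proposition 2.6 are our main technical results»)] -/
theorem mainResults_knitG (hd : 1 ≤ d) (hL : Odd L ∧ 1 < L) (ha : 0 < a) (δ₀ : ℝ)
    (Gp : ∀ i : TopIdx d L, B6.GpFamily (blockGeo d L a i)) : MainResults (knitBlockG d L a δ₀ Gp) :=
  mainResults_oneLevel d L a hd hL ha δ₀ Gp _ _ _ _ _ _

/-- **non-vacuity**: every member of the block's geometry family meets the hypotheses of the eight statements with the witness `M₁ = 1`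
((2.1)–(2.2) void, `M = 1`). [cite: Balaban1984PropagatorsII, (2.1)–(2.2) p.224] -/
theorem knitG_meets_hypotheses (δ₀ : ℝ) (Gp : ∀ i : TopIdx d L, B6.GpFamily (blockGeo d L a i)) (i : TopIdx d L) :
    ((knitBlockG d L a δ₀ Gp).geo i).Hyp21_22 ∧ (1 : ℝ) ≤ ((knitBlockG d L a δ₀ Gp).geo i).M :=
  ⟨trivial, le_rfl⟩

end Knit

section Leaf

variable (d L : ℕ) (a : ℝ)

/-- **THE LEAF `b6` ON ONE `BlockData` WITH THE GENUINE PROP. 2.5 CARRIER**: `DagBinding.B6BlockParam` — Lemma 2.1 (∃ c₁(α)) ∧ Prop. 2.2 ∧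
Prop. 2.3 ∧ Lemma 2.4 ∧ Prop. 2.5 ∧ Prop. 2.6 ∧ Prop. 2.7 ∧ Cor. 2.8, verbatim — holds for the knit block `knitBlockG` carrying the (2.67)
functionals of the genuine `G′_K` (`B6Prop22BlockFamily.blockGp`), for every `d ≥ 2`, odd `L > 1`, `a > 0`, `δ₀ > 0`, `m² ≥ 0`.
[cite: Balaban1984PropagatorsII, pp.223–250 (Lemma 2.1 p.234, Prop. 2.2 p.234, Prop. 2.3 p.238, Lemma 2.4 p.245, Prop. 2.5 p.246, Prop. 2.6 p.247, Prop. 2.7 p.249, Cor. 2.8 p.249); one level, constants ours] -/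
theorem b6BlockParam_oneLevel_famG (hd : 2 ≤ d) (hL : Odd L ∧ 1 < L) (ha : 0 < a) {δ₀ : ℝ} (hδ : 0 < δ₀) {msq : ℝ} (hmsq : 0 ≤ msq) :
    B6BlockParam (knitBlockG d L a δ₀ (blockGp d L a msq)) :=
  (b6BlockParam_knitG_iff d L a hd hL ha hδ (blockGp d L a msq)).mpr (prop22Printed_block d L a (le_trans one_le_two hd) hL ha hmsq)

/-- the printed block WITHOUT its Lemma 2.1 conjunct (`DagBinding.B6BlockRest`) on the same block. [cite: Balaban1984PropagatorsII, pp.223–250] -/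
theorem b6BlockRest_oneLevel_famG (hd : 2 ≤ d) (hL : Odd L ∧ 1 < L) (ha : 0 < a) {δ₀ : ℝ} (hδ : 0 < δ₀) {msq : ℝ} (hmsq : 0 ≤ msq) :
    B6BlockRest (knitBlockG d L a δ₀ (blockGp d L a msq)) :=
  (b6BlockParam_oneLevel_famG d L a hd hL ha hδ hmsq).2

/-- the «main technical results» (Prop. 2.6 ∧ Cor. 2.8, p. 249) as a corollary of the leaf (`DagBinding.b6BlockParam_mainResults`).
[cite: Balaban1984PropagatorsII, p.249] -/
theorem mainResults_oneLevel_famG (hd : 2 ≤ d) (hL : Odd L ∧ 1 < L) (ha : 0 < a) {δ₀ : ℝ} (hδ : 0 < δ₀) {msq : ℝ} (hmsq : 0 ≤ msq) :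
    MainResults (knitBlockG d L a δ₀ (blockGp d L a msq)) :=
  b6BlockParam_mainResults _ (b6BlockParam_oneLevel_famG d L a hd hL ha hδ hmsq)

/-- **THE LEAF `b6` HOLDS NON-VACUOUSLY ON THE NAMED BLOCK WHOSE PROP. 2.5 CARRIERS ARE r02's GENUINE SETTINGS**: for every `d ≥ 2`, odd
`L > 1`, `a > 0`, the block `knitBlockG d L a 1 (blockGp d L a 0)` (`δ₀ = 1`, `m² = 0`; its `loc k` carriers are `latticeSettingP12R (L^k) (Mk P k) a k`
by `knitBlockG_loc_S`) has an inhabited index family, all of its members meet `Hyp21_22 ∧ 1 ≤ M`, and `DagBinding.B6BlockParam` holds for it (the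
carrier-free existential `∃ D, …` is r03 g11's `B6LeafB6OneLevel.leaf_b6_inhabited`, not restated). [cite: Balaban1984PropagatorsII, pp.223–250; one level, constants ours] -/
theorem leaf_b6_knitG (hd : 2 ≤ d) (hL : Odd L ∧ 1 < L) (ha : 0 < a) :
    Nonempty (knitBlockG d L a 1 (blockGp d L a 0)).I ∧
      (∀ i, ((knitBlockG d L a 1 (blockGp d L a 0)).geo i).Hyp21_22 ∧ (1 : ℝ) ≤ ((knitBlockG d L a 1 (blockGp d L a 0)).geo i).M) ∧
      B6BlockParam (knitBlockG d L a 1 (blockGp d L a 0)) :=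
  ⟨B6Prop26OneScaleFromB5.topIdx_nonempty (le_trans one_le_two hd) hL,
    fun i => knitG_meets_hypotheses d L a 1 (blockGp d L a 0) i, b6BlockParam_oneLevel_famG d L a hd hL ha one_pos le_rfl⟩

end Leaf

end Literature.MathematicalPhysics.QuantumFieldTheory.Balaban1983to89.B6LeafB6OneLevelFamG

end
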